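import Summits.QuantumFields.BalabanUV.T4Continuum.Support.NE7MultiplierTermRecursion
import Summits.QuantumFields.BalabanUV.T4Continuum.Support.NE7TangentTransportGaugedTopDocked
import HarnessLib

/-!
# NE7MultiplierTermStepSharp — THE STEP OF THE MULTIPLIER-TERM SERIES IN ITS FINAL CURRENCY: `|Dm(0)[D²𝒢_{k+1,W}(0)[ψ,ψ]]| ≤ |Dm(0)[D²𝒢_{k,W̄}(0)[Tψ,Tψ]]| +
# 2·curl1C·ε · K_maj·(L∕L⁴)^{k+1} · (4∕rho0²)·4·(2·nbRad+1)⁴ · Σ_{b ∈ [0, N·L^{k+2})⁴} ‖ψ̃_b‖²` (`d = 4`, every `U(n)`, `L ≥ 2`) — the geometric weight `(L∕L^d)^{k+1} = L^{−3(k+1)}` of the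
# deeper levels is the `ℓ¹` contraction of row NE3's straight tower (ROAD-G116 §6 (G3): iterating this step down the bases `cavgIter i U♯` leaves exactly the LEVEL MASSES
# `Σ‖(dirIter i U♯ X̃)_b‖²` of the lift on the road's gauge slice)

Cell `pub-balaban`, rung (B)+1 sub-cell t4, lineage `b2b-balaban-t4-ne7b-p1` (row NE7b OWNER + CRUX PROVER; junction service for row NE7, ruling R-OWNER-149-1 (2)), generation 161.
Index `t4/b2b-balaban-t4-ne7b-p1/g161/INDEX.md`; memo `g161/records/SCOPING-G3.md`.  Over ✓ `NE7MultiplierTermRecursion.multiplierTerm_step_le` (this seat, (G)), the road's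
`L¹` norm of row NE3's positive majorant tower (✓ `NE7TangentTransportGaugedTopDocked.sum_norm_QbarIter_le_Kmaj` over ✓ `NE7MajorantL1` — any unitary base of the multi-level class, NO gauge
condition: the covariant line average has the flat `ℓ¹` weights) and ✓ `NE7OneStepConstraintCurvature.sum_norm_fderiv_fderiv_coord_le` (C).
WHAT ([folklore]; 0 def, 0 sorry):
* §1 `dirL1_extDir_eq_sum` (`dirL1 (extDir M c) (periodBox M) = Σ_{y,κ}‖c y κ‖`); the `ℓ¹` contraction of the straight tower is the road's ✓ `NE7TangentTransportGaugedTopDocked.sum_norm_QbarIter_le_Kmaj`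
  (`Σ_{z∈periodBox N}Σ_κ ‖QbarIter L (k+1) W Y z κ‖ ≤ K_maj(d,L)·(L∕L^d)^{k+1}·dirL1 Y (periodBox (N·L^{k+1}))`, `K_maj = exp((L^d∕L)·d·16(d+1)(d+4)L²·c_loc·2∕twoLevelSmall)`, `c_loc = 1250(nbRad+L) + 8dL + 2L`).
* §2 (`d = 4`) **`multiplierTerm_step_le_sharp`** — the displayed step, in the frame of ✓ `NE7MultiplierTermRecursion.multiplierTerm_step_le`.
HONEST FRAMING (page 1): composition of landed kernel theorems; constants BY NAME, not optimised; what is NOT here: the level masses of the lifts on a gauge slice and the final sum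
(the road's (G) assembly, with ✓ `NE7BorderedHessianGaugeDegenerate`); nothing of Bałaban's asserted; NOT (G), NOT NE7 as a spine node, NOT NE3; row NE7b NOT PRINTED ∕ NOT PROVED;
spine 0∕9; finite T⁴ rung (B)+1 — NOT infinite volume, NOT mass gap, NOT BetaPertH, NOT Clay.
-/

set_option autoImplicit false

open scoped BigOperators Matrix Matrix.Norms.L2Operator Topology
open NormedSpace Finset Set Filter Metric

namespace Summit.QuantumFields.BalabanUV.T4Continuum.NE7MultiplierTermStepSharp

open Literature.MathematicalPhysics.QuantumFieldTheory.Balaban1983to89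
open B7Prop1Explicit B7Prop2Explicit MatrixLog UnitaryModel
open T4AveragingDeficitWall (IsUnitaryCfg IsSkewDir SmallField dirL1 dirSq)
open T4AveragingDeficitWallBoundary (IsPeriodicCfg periodBox)
open AveragingDeficitPeriodicCounting (IsPeriodicDir)
open AveragingDeficitTorusChart (TDir chart chartDir extDir resDir redN_boxVec)
open AveragingDeficitChartCalculus (cavg coord)
open AveragingDeficitFermat (small512_of_liftSmall)
open AveragingDeficitTwoLevelPrep (skewSub twoLevelSmall prop1Radius smallness_of_twoLevelSmall)
open AveragingDeficitMultiLevelPrep (tower cavgIter levelQ LevelSmall natCast_tower_succ)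
open AveragingDeficitMultiLevelBridge (tower_eq)
open MinimalActionSandwich (IsMinimiser minAct)
open MinimalActionRate (sfClass)
open NE3TangentCovariantTower (QbarIter)
open NE3HatInvCurlLetters (curl1C curl1C_nonneg)
open BlockAverageVaryHolo (nbRad)
open BlockAverageVaryDisc (rho0)
open NE7TangentTransportGaugedTopDocked (sum_norm_QbarIter_le_Kmaj)
open NE7OneStepConstraintCurvature (sum_norm_fderiv_fderiv_coord_le)
open NE7ConstraintSecondDerivativeRecursion (cavg_levelSmall)
open NE7MultiplierTermRecursion (multiplierTerm_step_le)

noncomputable section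

variable {d : ℕ} {n : Type} [Fintype n] [DecidableEq n]

/-! ## §1 The `ℓ¹` norm of a periodic extension -/

/-- The `ℓ¹` norm of the periodic extension of a torus field over one period is the plain sum of its components. [folklore] -/
theorem dirL1_extDir_eq_sum {M : ℕ} [NeZero M] (c : TDir d n M) :
    dirL1 (extDir M c) (periodBox (d := d) M) = ∑ y : Fin d → Fin M, ∑ κ : Fin d, ‖c y κ‖ := by
  unfold dirL1
  rw [periodBox, Finset.sum_image fun r _ r' _ h => T4TermwiseTorus.boxVec_injective M h]
  refine Finset.sum_congr rfl fun r _ => Finset.sum_congr rfl fun κ _ => ?_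
  simp only [extDir, redN_boxVec]

/-! ## §2 The step in its final currency (`d = 4`) -/

/-- **THE MULTIPLIER TERM: ONE STEP DOWN THE TOWER, FINAL CURRENCY** (`d = 4`, every `U(n)`, `L ≥ 2`; the frame of ✓ `NE7MultiplierTermRecursion.multiplierTerm_step_le`): for every `k`,
every base `W` (unitary, `(tower L N (k+2))`-periodic, `SmallField W x`, `0 ≤ x`, `LevelSmall 4 L (k+1) x`) with `cavgIter L (k+2) W = V₀`, and every `ψ ∈ skewSub (L·tower L N (k+1))`:
`|Dm(0)[D²𝒢_{k+1,W}(0)[ψ,ψ]]| ≤ |Dm(0)[D²𝒢_{k,W̄}(0)[Tψ,Tψ]]| + 2·curl1C 4 L·ε·(K_maj(4,L)·(L∕L⁴)^{k+1})·((4∕rho0 4 L²)·(4·(2·nbRad 4 L+1)^4)·dirSq ψ̃ (periodBox (N·L^{k+2})))`.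
[folklore] -/
theorem multiplierTerm_step_le_sharp [Nonempty n] {L : ℕ} [NeZero L] (hL : 2 ≤ L) :
    ∃ ε₀ : ℝ, 0 < ε₀ ∧ ∀ ε : ℝ, 0 < ε → ε ≤ ε₀ → ∀ (N : ℕ) [NeZero N], 1 ≤ N → ∃ δV : ℝ, 0 < δV ∧ ∀ j : ℕ,
        ∀ V₀ ∈ {V : Site 4 → Fin 4 → (Matrix n n ℂ)ˣ | IsUnitaryCfg V ∧ IsPeriodicCfg V (N : ℤ) ∧ SmallField V δV},
        ∀ Us : Site 4 → Fin 4 → (Matrix n n ℂ)ˣ, IsMinimiser 4 (sfClass 4 L N ε) L N (j + 1) V₀ Us →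
        ∀ (k : ℕ) (W : Site 4 → Fin 4 → (Matrix n n ℂ)ˣ) (x : ℝ), IsUnitaryCfg W → IsPeriodicCfg W ((tower L N (k + 2) : ℕ) : ℤ) → 0 ≤ x →
          LevelSmall 4 L (k + 1) x → SmallField W x → cavgIter L (k + 2) W = V₀ →
        ∀ ψ : ↥(skewSub 4 n (L * tower L N (k + 1))),
          |fderiv ℝ (fun y : ↥(skewSub 4 n N) => minAct 4 (sfClass 4 L N ε) L N (j + 1) (chart (ContinuousLinearMap.id ℝ (Matrix n n ℂ)) N V₀ (y : TDir 4 n N))) 0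
              (fderiv ℝ (fderiv ℝ (fun Φ : TDir 4 n (L * tower L N (k + 1)) =>
                levelQ L N (k + 1) W (chart (ContinuousLinearMap.id ℝ (Matrix n n ℂ)) (L * tower L N (k + 1)) W Φ))) 0
                (ψ : TDir 4 n (L * tower L N (k + 1))) (ψ : TDir 4 n (L * tower L N (k + 1))))|
            ≤ |fderiv ℝ (fun y : ↥(skewSub 4 n N) => minAct 4 (sfClass 4 L N ε) L N (j + 1) (chart (ContinuousLinearMap.id ℝ (Matrix n n ℂ)) N V₀ (y : TDir 4 n N))) 0
                (fderiv ℝ (fderiv ℝ (fun Φ' : TDir 4 n (L * tower L N k) =>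
                  levelQ L N k (cavg L W) (chart (ContinuousLinearMap.id ℝ (Matrix n n ℂ)) (L * tower L N k) (cavg L W) Φ'))) 0
                  (fderiv ℝ (coord (ContinuousLinearMap.id ℝ (Matrix n n ℂ)) L (L * tower L N k) W) 0 (ψ : TDir 4 n (L * tower L N (k + 1))))
                  (fderiv ℝ (coord (ContinuousLinearMap.id ℝ (Matrix n n ℂ)) L (L * tower L N k) W) 0 (ψ : TDir 4 n (L * tower L N (k + 1)))))|
              + 2 * curl1C 4 L * ε
                * ((Real.exp (((L : ℝ) ^ 4 / L) * (((4 : ℕ) : ℝ) * (16 * (((4 : ℕ) : ℝ) + 1) * (((4 : ℕ) : ℝ) + 4) * (L : ℝ) ^ 2)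
                      * (1250 * ((nbRad 4 L : ℝ) + L) + 8 * ((((4 : ℕ) : ℝ)) * L) + 2 * L)) * (2 / twoLevelSmall 4 L))
                    * ((L : ℝ) / (L : ℝ) ^ 4) ^ (k + 1))
                  * (4 / rho0 4 L ^ 2 * ((4 : ℕ) * (2 * nbRad 4 L + 1) ^ 4)
                    * dirSq (chartDir (ContinuousLinearMap.id ℝ (Matrix n n ℂ)) (L * tower L N (k + 1)) (ψ : TDir 4 n (L * tower L N (k + 1))))
                      (periodBox (d := 4) (L * tower L N (k + 1))))) := by
  obtain ⟨ε₀, hε₀, H⟩ := multiplierTerm_step_le (n := n) hL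
  have hL1 : 1 ≤ L := le_trans (by norm_num) hL
  refine ⟨ε₀, hε₀, fun ε hε hεle N _ hN => ?_⟩
  obtain ⟨δV, hδV, H1⟩ := H ε hε hεle N hN
  refine ⟨δV, hδV, fun j V₀ hV₀ Us hUs k W x hWu hWP hx hs hWx htop ψ => ?_⟩
  have hstep := H1 j V₀ hV₀ Us hUs k W x hWu hWP hx hs hWx htop ψ
  refine hstep.trans (add_le_add le_rfl ?_)
  have hC : 0 ≤ 2 * curl1C 4 L * ε := by have := curl1C_nonneg 4 L; positivity
  refine mul_le_mul_of_nonneg_left ?_ hC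
  -- the base one level up and the curvature field
  have hWP' : IsPeriodicCfg W ((L : ℤ) * (tower L N (k + 1) : ℕ)) := by rw [← natCast_tower_succ]; exact hWP
  obtain ⟨x', hx', hs', hWu', hWbP, hWx', -⟩ := cavg_levelSmall (M' := N) hL1 k hWu hWP' hx hs hWx
  set c : TDir 4 n (L * tower L N k) := fderiv ℝ (fderiv ℝ (coord (ContinuousLinearMap.id ℝ (Matrix n n ℂ)) L (L * tower L N k) W)) 0
      (ψ : TDir 4 n (L * tower L N (k + 1))) (ψ : TDir 4 n (L * tower L N (k + 1))) with hc
  -- (i) the straight tower contracts the ℓ¹ mass of the curvature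
  have hcP : IsPeriodicDir (extDir (L * tower L N k) c) ((N * L ^ (k + 1) : ℕ) : ℤ) := by
    have h := AveragingDeficitTorusChart.isPeriodicDir_extDir (L * tower L N k) c
    have e : ((L * tower L N k : ℕ) : ℤ) = ((N * L ^ (k + 1) : ℕ) : ℤ) := by rw [tower_eq]; push_cast; ring
    rw [e] at h; exact h
  have h1 := sum_norm_QbarIter_le_Kmaj (d := 4) hL k hWu' hx' hs' hWx' hcP
  have hdir : dirL1 (QbarIter L (k + 1) (cavg L W) (extDir (L * tower L N k) c)) (periodBox (d := 4) N)
      = ∑ z ∈ periodBox (d := 4) N, ∑ κ : Fin 4, ‖QbarIter L (k + 1) (cavg L W) (extDir (L * tower L N k) c) z κ‖ := rfl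
  rw [hdir]
  refine h1.trans ?_
  -- (ii) the ℓ¹ mass of the curvature against the ℓ² mass of the direction
  haveI : NeZero (L * tower L N k) := ⟨Nat.mul_ne_zero (by omega) (AveragingDeficitMultiLevelPrep.tower_ne_zero L N k)⟩
  have e2 : ((N * L ^ (k + 1) : ℕ)) = L * tower L N k := by rw [tower_eq]; ring
  have h2 : dirL1 (extDir (L * tower L N k) c) (periodBox (d := 4) (N * L ^ (k + 1))) = ∑ y : Fin 4 → Fin (L * tower L N k), ∑ κ : Fin 4, ‖c y κ‖ := by
    rw [e2]; exact dirL1_extDir_eq_sum c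
  obtain ⟨hlift, -, -, -⟩ := smallness_of_twoLevelSmall (d := 4) hL1 hx hs.1
  have h512 := small512_of_liftSmall hL1 hx hlift
  have hM : 1 ≤ L * tower L N k := Nat.one_le_iff_ne_zero.mpr (Nat.mul_ne_zero (by omega) (AveragingDeficitMultiLevelPrep.tower_ne_zero L N k))
  have h3 := sum_norm_fderiv_fderiv_coord_le (d := 4) (M := L * tower L N k) hL1 hM hWu hx h512 hWx (ψ : TDir 4 n (L * tower L N (k + 1)))
  have hK : 0 ≤ Real.exp (((L : ℝ) ^ 4 / L) * (((4 : ℕ) : ℝ) * (16 * (((4 : ℕ) : ℝ) + 1) * (((4 : ℕ) : ℝ) + 4) * (L : ℝ) ^ 2)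
        * (1250 * ((nbRad 4 L : ℝ) + L) + 8 * ((((4 : ℕ) : ℝ)) * L) + 2 * L)) * (2 / twoLevelSmall 4 L))
      * ((L : ℝ) / (L : ℝ) ^ 4) ^ (k + 1) := by positivity
  rw [h2]
  exact mul_le_mul_of_nonneg_left h3 hK

end

end Summit.QuantumFields.BalabanUV.T4Continuum.NE7MultiplierTermStepSharp
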